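import Literature.NumberTheory.Automorphic.IsobaricRigidityRepData
import HarnessLib

/-!
# Crux `SelfTwistedIrreducible` (stmt-Langlands-18055), line `Sketch`: isobaric rigidity for
# `π ⊞ π^τ` against cuspidal data of other ranks (auxiliary file of stub `stub_noFourCharacters`)

Let `E/F` be an extension of number fields (only `E` need be a number field), `τ ∈ Aut(E/F)`
acting on the finite places of `E` (`τ • w`, `GaloisActionPlaces`), `π` a cuspidal Borel–Jacquet
datum on `GL_n(𝔸_E)` (`n ≥ 1`) and `σ_i` (`i < k`) cuspidal data on `GL_{m_i}(𝔸_E)` with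
`1 ≤ m_i ≠ n`.  **Claim** (`not_eventually_satake_add_smul_eq_sum_of_JS`): it is NOT the case that
at almost every place `w`, for all Satake parameters `a` of `π` at `w` and `a'` of `π` at `τ • w`,
`a ⊔ a' = ⨆_i t_{σ_i,w}` for Satake parameters `t_{σ_i,w}` of the `σ_i` — the unramified shadow of
Jacquet–Shalika's rigidity of isobaric sums (JS 1981 II, Thm. 4.4) for `π ⊞ π^τ`, granted
Arthur–Clozel Ch. 3 (2.2)–(2.3) for Borel–Jacquet data (hypotheses `hJSb`, `hJSp`, the named facts
`JacquetShalika1981_partialPairL_boundary_repData` / `…_pole_repData`).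

**Proof** — the argument of `CuspidalAutomorphicRepData.not_eventually_satake_eq_sum_of_JS`
(Arthur–Clozel, Ch. 3, proof of Thm. 4.2 (d), pp. 206–207) with one change.  Normalise
`t_{π,w} = q_w^{s₀} α₀(w)` (unitary `α₀`, Borel–Jacquet 5.7, `exists_unitary_avatar_smul`, which also
realises `w ↦ α₀(τ • w)` as the Satake family of a cuspidal datum `π_c`: the Galois conjugate
`U_{τ⁻¹}(Π)` in `L²_cusp`, `CuspidalAutomorphicRepGL.galConj`, `IsSatakeFamilyOf.galConj`) and
`t_{σ_i,w} = q_w^{s_i} α_i(w)`; since `q_{τ w} = q_w` the hypothesis reads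
`α₀(w) ⊔ α₀(τ w) = ⨆_i q_w^{s_i - s₀} α_i(w)` off a finite set, whence `∑_i m_i Re(s_i - s₀) = 0` and,
for `i₀` with `Re s_{i₀}` maximal, `Re s₀ ≤ Re s_{i₀}`.  With `σ̃` the contragredient of the unitary
avatar of `σ_{i₀}` and `u₀ = 1 - s₀ + s_{i₀}`, for real `t > 0`
`L^S(u₀ + t, α₀ ⊗ α_{i₀}⁻¹) · L^S(u₀ + t, (α₀ ∘ τ) ⊗ α_{i₀}⁻¹) = ∏_i L^S(1 + s_{i₀} - s_i + t, α_i ⊗ α_{i₀}⁻¹)`.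
Both factors on the left are `GL_n × GL_{m_{i₀}}` functions of PAIRS OF CUSPIDAL DATA (`π_u`, resp.
`π_c`, against `σ̃`) with `n ≠ m_{i₀}`, so have finite limits as `t → 0⁺` ((2.2), off `X`
vacuously); on the right every factor has a finite non-zero limit after multiplication by `t^{e_i}`,
with `e_{i₀} = 1` ((2.3)).  So `t^E · LHS → 0`, `t^E · RHS → ∏ c_i ≠ 0` (`E ≥ 1`): contradiction.

References: Jacquet–Shalika, Amer. J. Math. 103 (1981), Thm. 4.4 [JacquetShalikaAJM1981II];
Arthur–Clozel, Ann. of Math. Stud. 120, Ch. 3 §2 (2.1)–(2.3), Thm. 4.2 (d) [ArthurClozelAMS120];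
Borel–Jacquet, Corvallis (1979), 4.6, 5.7 [BorelJacquetCorvallis1979].
-/

set_option linter.dupNamespace false -- `Summit.Langlands.Langlands` is the mandated namespace

noncomputable section

namespace Summit.Langlands.Langlands.Cruxes.SelfTwistedIrreducible.DetPinning

open scoped Topology Classical NumberField
open NumberField IsDedekindDomain MeasureTheory Filter Polynomial
open Literature.NumberTheory.Automorphic AdelicGroupData

/-! ### Unitary avatars of `π` and of its Galois conjugate -/

section Avatar

variable {F : Type} [Field F] {E : Type} [Field E] [NumberField E] [Algebra F E] {n : ℕ}

/-- **Unitary normalisation with Borel–Jacquet avatars of `π` and `π^τ`.**  For a cuspidal datum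
`π` on `GL_n(𝔸_E)` (`n ≥ 1`) and `τ ∈ Aut(E/F)` there are `s ∈ ℂ`, a finite `S`, a Satake family `α`
and cuspidal data `π_u`, `π_c` such that off `S`: the Satake parameters of `π` at `w` are exactly
`q_w^{s} α(w)`, `π_u` has parameter `α(w)`, `π_c` has parameter `α(τ • w)`, `|∏ α(w)| = 1`,
`card α(w) = n`.  (`exists_normalisation_L2`, Borel–Jacquet 5.7; the conjugate `U_{τ⁻¹}(Π)` with
Satake family `w ↦ α(τ • w)`, `IsSatakeFamilyOf.galConj`, automorphic measures being
`Aut(E/F)`-invariant by `isGalInvariant_of_unique`; back to data by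
`CuspidalAutomorphicRepGL.exists_cuspidalRepData_eventually_hasSatakeParamAt`.) [folklore] -/
theorem exists_unitary_avatar_smul [NeZero n] (τ : E ≃ₐ[F] E)
    (hE : isCompact_glFiniteIntegralLevel n E) (π : CuspidalAutomorphicRepData n E hE) :
    ∃ (s : ℂ) (S : Set (HeightOneSpectrum (𝓞 E))) (α : SatakeFamily E)
      (πu πc : CuspidalAutomorphicRepData n E hE), S.Finite ∧
      (∀ w ∉ S, ∀ β : Multiset ℂ,
        π.1.HasSatakeParamAt w β ↔ β = (α w).map (((w.residueCard : ℂ) ^ s) * ·)) ∧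
      (∀ w ∉ S, πu.1.HasSatakeParamAt w (α w)) ∧
      (∀ w ∉ S, πc.1.HasSatakeParamAt w (α (τ • w))) ∧
      (∀ w ∉ S, ‖(α w).prod‖ = 1) ∧ (∀ w ∉ S, Multiset.card (α w) = n) := by
  obtain ⟨μ, hμ⟩ := AdelicGroupData.exists_isAutomorphicMeasure_gl_holds n E
  haveI := hμ
  have hμG : IsGalInvariant F μ :=
    isGalInvariant_of_unique F (isAutomorphicMeasure_unique_smul_holds n E) μ
  obtain ⟨s, P, S₁, α, hS₁, hα, hiff⟩ := CuspidalAutomorphicRepData.exists_normalisation_L2 hE μ π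
  obtain ⟨πu, hπu⟩ :=
    CuspidalAutomorphicRepGL.exists_cuspidalRepData_eventually_hasSatakeParamAt hE P hα hS₁
  have hαc : IsSatakeFamilyOf (P.galConj F hμG τ⁻¹) ((τ • ·) ⁻¹' S₁) (fun w => α (τ • w)) := by
    have h := hα.galConj F hμG τ⁻¹
    rwa [inv_inv] at h
  obtain ⟨πc, hπc⟩ :=
    CuspidalAutomorphicRepGL.exists_cuspidalRepData_eventually_hasSatakeParamAt hE _ hαc
      (hS₁.preimage (MulAction.injective τ).injOn)
  rw [Filter.eventually_cofinite] at hπu hπc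
  refine ⟨s, S₁ ∪ {v | ¬ πu.1.HasSatakeParamAt v (α v)} ∪
    {v | ¬ πc.1.HasSatakeParamAt v (α (τ • v))}, α, πu, πc, (hS₁.union hπu).union hπc,
    ?_, ?_, ?_, ?_, ?_⟩
  · exact fun w hw β => hiff w (fun h => hw (Or.inl (Or.inl h))) β
  · exact fun w hw => not_not.mp fun h => hw (Or.inl (Or.inr h))
  · exact fun w hw => not_not.mp fun h => hw (Or.inr h)
  · intro w hw
    obtain ⟨𝔫, -, -, ϖ, hSat⟩ := hα w (fun h => hw (Or.inl (Or.inl h)))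
    exact hSat.norm_prod_eq_one
  · intro w hw
    obtain ⟨𝔫, -, -, ϖ, hSat⟩ := hα w (fun h => hw (Or.inl (Or.inl h)))
    exact hSat.card_eq

end Avatar

/-! ### Isobaric rigidity for `π ⊞ π^τ` -/

section Rigidity

/-- **Isobaric rigidity at unramified places for `π ⊞ π^τ` (Jacquet–Shalika II, Thm. 4.4, for
Borel–Jacquet data), from Arthur–Clozel (2.2)–(2.3).**  For `τ ∈ Aut(E/F)`, a cuspidal `π` on
`GL_n(𝔸_E)` (`n ≥ 1`) and cuspidal `σ_i` on `GL_{m_i}(𝔸_E)` (`i < k`, `1 ≤ m_i ≠ n`), it is not true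
that at almost every place `v`, for every Satake parameter `a` of `π` at `v` and `a'` of `π` at
`τ • v`, `a + a'` is a sum `∑_i β_i` of Satake parameters `β_i` of the `σ_i` at `v`.  Hypotheses: the
named facts `JacquetShalika1981_partialPairL_boundary_repData` ((2.2)) and
`JacquetShalika1981_partialPairL_pole_repData` ((2.3)); proof in the module docstring.
[cite: JacquetShalikaAJM1981II, Thm. 4.4] [cite: ArthurClozelAMS120, Ch. 3, proof of Thm. 4.2 (d), pp. 206–207] -/
theorem not_eventually_satake_add_smul_eq_sum_of_JS :
    JacquetShalika1981_partialPairL_boundary_repData → JacquetShalika1981_partialPairL_pole_repData →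
    ∀ (F E : Type) [Field F] [Field E] [NumberField E] [Algebra F E] (τ : E ≃ₐ[F] E)
      (n : ℕ) (hcpt : isCompact_glFiniteIntegralLevel n E) (π : CuspidalAutomorphicRepData n E hcpt)
      (k : ℕ) (m : Fin k → ℕ) (hm : ∀ i, isCompact_glFiniteIntegralLevel (m i) E)
      (σ : ∀ i, CuspidalAutomorphicRepData (m i) E (hm i)), 0 < n → (∀ i, 0 < m i) → (∀ i, m i ≠ n) →
      ¬ ∀ᶠ v : HeightOneSpectrum (𝓞 E) in cofinite, ∀ a a' : Multiset ℂ, π.1.HasSatakeParamAt v a →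
          π.1.HasSatakeParamAt (τ • v) a' →
            ∃ β : Fin k → Multiset ℂ, (∀ i, (σ i).1.HasSatakeParamAt v (β i)) ∧ a + a' = ∑ i, β i := by
  intro hJSb hJSp F E _ _ _ _ τ n hcpt π k m hm σ hn hm0 hmn H
  have hq1 : ∀ w : HeightOneSpectrum (𝓞 E), (1 : ℝ) < (w.residueCard : ℝ) := fun w => by
    exact_mod_cast w.one_lt_residueCard
  have hq0 : ∀ w : HeightOneSpectrum (𝓞 E), ((w.residueCard : ℕ) : ℂ) ≠ 0 := fun w =>
    Nat.cast_ne_zero.mpr (zero_lt_one.trans w.one_lt_residueCard).ne'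
  -- Step 1: unitary avatars of `π`, `π^τ` and of the `σ i`
  haveI : NeZero n := ⟨hn.ne'⟩
  obtain ⟨s₀, Sπ, α₀, πu, πc, hSπ, hiff₀, hπu, hπc, hu₀, hcard₀⟩ :=
    exists_unitary_avatar_smul τ hcpt π
  have hav : ∀ i, ∃ (s : ℂ) (S : Set (HeightOneSpectrum (𝓞 E))) (α : SatakeFamily E)
      (σu : CuspidalAutomorphicRepData (m i) E (hm i)), S.Finite ∧
      (∀ w ∉ S, ∀ β : Multiset ℂ,
        (σ i).1.HasSatakeParamAt w β ↔ β = (α w).map (((w.residueCard : ℂ) ^ s) * ·)) ∧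
      (∀ w ∉ S, σu.1.HasSatakeParamAt w (α w)) ∧
      (∀ w ∉ S, ‖(α w).prod‖ = 1) ∧ (∀ w ∉ S, Multiset.card (α w) = m i) := fun i => by
    haveI : NeZero (m i) := ⟨(hm0 i).ne'⟩
    exact (σ i).exists_unitary_avatar (hm i)
  choose s S α σu hSfin hiff hσu hu hcard using hav
  -- Step 2: the exceptional set of the hypothesis and the normalised isobaric relation
  obtain ⟨T, hTfin, hT⟩ : ∃ T : Set (HeightOneSpectrum (𝓞 E)), T.Finite ∧ ∀ v ∉ T,
      ∀ a a' : Multiset ℂ, π.1.HasSatakeParamAt v a → π.1.HasSatakeParamAt (τ • v) a' →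
        ∃ β : Fin k → Multiset ℂ, (∀ i, (σ i).1.HasSatakeParamAt v (β i)) ∧ a + a' = ∑ i, β i := by
    rw [Filter.eventually_cofinite] at H
    exact ⟨_, H, fun v hv => not_not.mp hv⟩
  set S₁ : Set (HeightOneSpectrum (𝓞 E)) := Sπ ∪ ((τ • ·) ⁻¹' Sπ) ∪ T ∪ ⋃ i, S i with hS₁def
  have hS₁fin : S₁.Finite :=
    ((hSπ.union (hSπ.preimage (MulAction.injective τ).injOn)).union hTfin).union
      (Set.finite_iUnion hSfin)
  have hS₁π : ∀ w ∉ S₁, w ∉ Sπ := fun w hw h => hw (Or.inl (Or.inl (Or.inl h)))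
  have hS₁τ : ∀ w ∉ S₁, τ • w ∉ Sπ := fun w hw h => hw (Or.inl (Or.inl (Or.inr h)))
  have hS₁T : ∀ w ∉ S₁, w ∉ T := fun w hw h => hw (Or.inl (Or.inr h))
  have hS₁i : ∀ w ∉ S₁, ∀ i, w ∉ S i := fun w hw i h => hw (Or.inr (Set.mem_iUnion.mpr ⟨i, h⟩))
  -- the conjugate family and the combined family `A(w) = α₀(w) + α₀(τ w)`
  set α₀τ : SatakeFamily E := fun w => α₀ (τ • w) with hα₀τ
  set A : SatakeFamily E := fun w => α₀ w + α₀ (τ • w) with hAdef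
  -- `q^{s₀} A(w) = ∑ i, q^{s i} α i (w)` off `S₁`
  have hrel : ∀ w ∉ S₁, (A w).map ((((w.residueCard : ℂ) ^ s₀)) * ·) =
      ∑ i, (α i w).map ((((w.residueCard : ℂ) ^ s i)) * ·) := by
    intro w hw
    have h1 : π.1.HasSatakeParamAt w ((α₀ w).map ((((w.residueCard : ℂ) ^ s₀)) * ·)) :=
      (hiff₀ w (hS₁π w hw) _).2 rfl
    have h2 : π.1.HasSatakeParamAt (τ • w)
        ((α₀ (τ • w)).map ((((w.residueCard : ℂ) ^ s₀)) * ·)) := by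
      have h := (hiff₀ (τ • w) (hS₁τ w hw) _).2 rfl
      rwa [residueCard_smul F τ w] at h
    obtain ⟨β, hβ, hsum⟩ := hT w (hS₁T w hw) _ _ h1 h2
    rw [hAdef, Multiset.map_add, hsum]
    exact Finset.sum_congr rfl fun i _ => (hiff i w (hS₁i w hw i) (β i)).1 (hβ i)
  -- `A(w) = ∑ i, q^{s i - s₀} α i (w)` off `S₁`
  have hrel' : ∀ w ∉ S₁,
      A w = ∑ i, (α i w).map ((((w.residueCard : ℂ) ^ (s i - s₀))) * ·) := by
    intro w hw
    have h := congrArg (Multiset.map ((((w.residueCard : ℂ) ^ (-s₀))) * ·)) (hrel w hw)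
    rw [Multiset.map_map, multiset_map_mul_sum] at h
    have hL : ((fun x => (w.residueCard : ℂ) ^ (-s₀) * x) ∘ fun x => (w.residueCard : ℂ) ^ s₀ * x) =
        id := by
      funext x
      simp only [Function.comp_apply, id_eq, ← mul_assoc, ← Complex.cpow_add _ _ (hq0 w),
        neg_add_cancel, Complex.cpow_zero, one_mul]
    rw [hL, Multiset.map_id] at h
    rw [h]
    refine Finset.sum_congr rfl fun i _ => ?_
    rw [Multiset.map_map]
    refine Multiset.map_congr rfl fun x _ => ?_
    simp only [Function.comp_apply, ← mul_assoc, ← Complex.cpow_add _ _ (hq0 w)]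
    congr 2
    ring
  -- unitarity and rank of the combined family
  have hu₀A : ∀ w ∉ S₁, ‖(A w).prod‖ = 1 := fun w hw => by
    rw [hAdef, Multiset.prod_add, norm_mul, hu₀ w (hS₁π w hw), hu₀ (τ • w) (hS₁τ w hw), mul_one]
  have hcardA : ∀ w ∉ S₁, Multiset.card (A w) = n + n := fun w hw => by
    rw [hAdef, Multiset.card_add, hcard₀ w (hS₁π w hw), hcard₀ (τ • w) (hS₁τ w hw)]
  -- Step 3: one good place; ranks and exponents
  haveI := infinite_heightOneSpectrum' E
  obtain ⟨w₀, -, hw₀⟩ := ((Set.infinite_univ (α := HeightOneSpectrum (𝓞 E))).sdiff hS₁fin).nonempty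
  have hnsum : n + n = ∑ i, m i := by
    have h := congrArg Multiset.card (hrel w₀ hw₀)
    rw [Multiset.card_map, hcardA w₀ hw₀, Multiset.card_sum] at h
    rw [h]
    exact Finset.sum_congr rfl fun i _ => by rw [Multiset.card_map, hcard i w₀ (hS₁i w₀ hw₀ i)]
  -- the exponent identity `∑ i, m i (Re s i - Re s₀) = 0`
  have hexp : ∑ i, (m i : ℝ) * ((s i).re - s₀.re) = 0 := by
    have h : ‖(A w₀).prod‖ =
        ‖(∑ i, (α i w₀).map ((((w₀.residueCard : ℂ) ^ (s i - s₀))) * ·)).prod‖ :=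
      congrArg (fun M : Multiset ℂ => ‖M.prod‖) (hrel' w₀ hw₀)
    rw [hu₀A w₀ hw₀, Multiset.prod_sum, norm_prod] at h
    refine sum_mul_eq_zero_of_prod_rpow_eq_one Finset.univ m _ (hq1 w₀) ?_
    rw [h]
    refine Finset.prod_congr rfl fun i _ => ?_
    rw [prod_map_const_mul_eq, hcard i w₀ (hS₁i w₀ hw₀ i), norm_mul, norm_pow,
      hu i w₀ (hS₁i w₀ hw₀ i), mul_one,
      Complex.norm_natCast_cpow_of_pos (zero_lt_one.trans w₀.one_lt_residueCard), Complex.sub_re]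
  -- `i₀` with maximal real twist exponent; then `Re s₀ ≤ Re s i₀` and `n ≠ m i₀`
  have hk0 : 0 < k := by
    rcases Nat.eq_zero_or_pos k with hk | hk
    · subst hk
      rw [Finset.sum_of_isEmpty] at hnsum
      omega
    · exact hk
  obtain ⟨i₀, -, hi₀⟩ :=
    Finset.exists_max_image Finset.univ (fun i => (s i).re) ⟨⟨0, hk0⟩, Finset.mem_univ _⟩
  have hx₀ : s₀.re ≤ (s i₀).re := by
    by_contra hlt
    push Not at hlt
    have hneg : ∑ i, (m i : ℝ) * ((s i).re - s₀.re) < 0 := by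
      refine Finset.sum_neg (fun i _ => mul_neg_of_pos_of_neg (by exact_mod_cast hm0 i) ?_)
        ⟨i₀, Finset.mem_univ _⟩
      linarith [hi₀ i (Finset.mem_univ _)]
    exact hneg.ne hexp
  have hnm : n ≠ m i₀ := (hmn i₀).symm
  -- Step 4: the contragredient `σd` of `σu i₀`, with the unitary family `α i₀ ⁻¹`
  obtain ⟨σd, hσd⟩ := CuspidalAutomorphicRepData.exists_contragredient_satake_holds (hm i₀) (σu i₀)
  set αd : SatakeFamily E := fun w => (α i₀ w).map (·⁻¹) with hαd
  have hσdd : ∀ w ∉ S₁, σd.1.HasSatakeParamAt w (αd w) := fun w hw =>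
    hσd w _ (hσu i₀ w (hS₁i w hw i₀))
  have hud : ∀ w ∉ S₁, ‖(αd w).prod‖ = 1 := fun w hw => by
    simp only [hαd]
    rw [Multiset.prod_map_inv', norm_inv, hu i₀ w (hS₁i w hw i₀), inv_one]
  -- Step 5: the finite set `S` absorbing every `S₀` of the analytic inputs
  have hA : ∀ i, ∃ S₀ : Set (HeightOneSpectrum (𝓞 E)), S₀.Finite ∧
      ∀ {S' : Set (HeightOneSpectrum (𝓞 E))} (_hS : S'.Finite) (_hS₀ : S₀ ⊆ S')
        {α' β' : SatakeFamily E} (_hα : ∀ w ∉ S', (σu i).1.HasSatakeParamAt w (α' w))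
        (_hβ : ∀ w ∉ S', σd.1.HasSatakeParamAt w (β' w))
        (_hu : ∀ w ∉ S', ‖(α' w).prod‖ = 1) (_hu' : ∀ w ∉ S', ‖(β' w).prod‖ = 1)
        {z : ℂ} (_hz : 1 ≤ z.re),
        ∃ (e : ℕ) (c : ℂ), c ≠ 0 ∧ (m i ≠ m i₀ → e = 0) ∧
          Tendsto (fun t : ℝ => (t : ℂ) ^ e * partialPairL S' α' β' (z + t)) (𝓝[>] (0 : ℝ))
            (𝓝 c) := fun i =>
    exists_tendsto_pow_mul_partialPairL_ofReal_add hJSb hJSp (hm0 i) (hm0 i₀) (σu i) σd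
  choose SA hSAfin hSA using hA
  obtain ⟨SB, hSBfin, hSB⟩ := exists_tendsto_ofReal_mul_partialPairL_dual hJSp (hm0 i₀) (σu i₀) σd
  obtain ⟨SL, hSLfin, hSL⟩ :=
    exists_tendsto_pow_mul_partialPairL_ofReal_add hJSb hJSp hn (hm0 i₀) πu σd
  obtain ⟨SL', hSL'fin, hSL'⟩ :=
    exists_tendsto_pow_mul_partialPairL_ofReal_add hJSb hJSp hn (hm0 i₀) πc σd
  have h21 : ∀ i, ∃ S₀ : Set (HeightOneSpectrum (𝓞 E)), S₀.Finite ∧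
      ∀ {S' : Set (HeightOneSpectrum (𝓞 E))} (_hS : S'.Finite) (_hS₀ : S₀ ⊆ S')
        {α' β' : SatakeFamily E} (_hα : ∀ w ∉ S', (σu i).1.HasSatakeParamAt w (α' w))
        (_hβ : ∀ w ∉ S', σd.1.HasSatakeParamAt w (β' w))
        (_hu : ∀ w ∉ S', ‖(α' w).prod‖ = 1) (_hu' : ∀ w ∉ S', ‖(β' w).prod‖ = 1)
        {z : ℂ} (_hs : 1 < z.re),
        Multipliable fun v : {v : HeightOneSpectrum (𝓞 E) // v ∉ S'} =>
          ((satakePairPolynomial (α' v.1) (β' v.1)).eval ((v.1.residueCard : ℂ) ^ (-z)))⁻¹ :=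
    fun i => JacquetShalika1981_multipliable_partialPairL_repData_holds (m i) (m i₀) E (hm i)
      (hm i₀) (hm0 i) (hm0 i₀) (σu i) σd
  choose S2 hS2fin hS2 using h21
  obtain ⟨S2u, hS2ufin, hS2u⟩ := JacquetShalika1981_multipliable_partialPairL_repData_holds n (m i₀)
    E hcpt (hm i₀) hn (hm0 i₀) πu σd
  obtain ⟨S2c, hS2cfin, hS2c⟩ := JacquetShalika1981_multipliable_partialPairL_repData_holds n (m i₀)
    E hcpt (hm i₀) hn (hm0 i₀) πc σd
  set S : Set (HeightOneSpectrum (𝓞 E)) :=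
    S₁ ∪ SL ∪ SL' ∪ SB ∪ (⋃ i, SA i) ∪ (⋃ i, S2 i) ∪ S2u ∪ S2c with hSdef
  have hSfin : S.Finite :=
    ((((((hS₁fin.union hSLfin).union hSL'fin).union hSBfin).union (Set.finite_iUnion hSAfin)).union
      (Set.finite_iUnion hS2fin)).union hS2ufin).union hS2cfin
  have hS₁S : S₁ ⊆ S := fun x h =>
    Or.inl (Or.inl (Or.inl (Or.inl (Or.inl (Or.inl (Or.inl h))))))
  have hSLS : SL ⊆ S := fun x h =>
    Or.inl (Or.inl (Or.inl (Or.inl (Or.inl (Or.inl (Or.inr h))))))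
  have hSL'S : SL' ⊆ S := fun x h => Or.inl (Or.inl (Or.inl (Or.inl (Or.inl (Or.inr h)))))
  have hSBS : SB ⊆ S := fun x h => Or.inl (Or.inl (Or.inl (Or.inl (Or.inr h))))
  have hSAS : ∀ i, SA i ⊆ S := fun i x h =>
    Or.inl (Or.inl (Or.inl (Or.inr (Set.mem_iUnion.mpr ⟨i, h⟩))))
  have hS2S : ∀ i, S2 i ⊆ S := fun i x h => Or.inl (Or.inl (Or.inr (Set.mem_iUnion.mpr ⟨i, h⟩)))
  have hS2uS : S2u ⊆ S := fun x h => Or.inl (Or.inr h)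
  have hS2cS : S2c ⊆ S := fun x h => Or.inr h
  have hnot₁ : ∀ w ∉ S, w ∉ S₁ := fun w hw h => hw (hS₁S h)
  -- the families off `S`
  have hαS : ∀ i, ∀ w ∉ S, (σu i).1.HasSatakeParamAt w (α i w) := fun i w hw =>
    hσu i w (hS₁i w (hnot₁ w hw) i)
  have huS : ∀ i, ∀ w ∉ S, ‖(α i w).prod‖ = 1 := fun i w hw => hu i w (hS₁i w (hnot₁ w hw) i)
  have hσdS : ∀ w ∉ S, σd.1.HasSatakeParamAt w (αd w) := fun w hw => hσdd w (hnot₁ w hw)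
  have hudS : ∀ w ∉ S, ‖(αd w).prod‖ = 1 := fun w hw => hud w (hnot₁ w hw)
  have hπuS : ∀ w ∉ S, πu.1.HasSatakeParamAt w (α₀ w) := fun w hw => hπu w (hS₁π w (hnot₁ w hw))
  have hu₀S : ∀ w ∉ S, ‖(α₀ w).prod‖ = 1 := fun w hw => hu₀ w (hS₁π w (hnot₁ w hw))
  have hπcS : ∀ w ∉ S, πc.1.HasSatakeParamAt w (α₀τ w) := fun w hw => hπc w (hS₁π w (hnot₁ w hw))
  have hu₀cS : ∀ w ∉ S, ‖(α₀τ w).prod‖ = 1 := fun w hw => hu₀ (τ • w) (hS₁τ w (hnot₁ w hw))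
  -- Step 6: the points `u₀ = 1 - s₀ + s i₀`, `z i = 1 + s i₀ - s i` (all with `Re ≥ 1`)
  set u₀ : ℂ := 1 - s₀ + s i₀ with hu₀def
  set z : Fin k → ℂ := fun i => 1 + s i₀ - s i with hzdef
  have hu₀re : 1 ≤ u₀.re := by
    simp only [hu₀def, Complex.add_re, Complex.sub_re, Complex.one_re]
    linarith
  have hzre : ∀ i, 1 ≤ (z i).re := fun i => by
    simp only [hzdef, Complex.add_re, Complex.sub_re, Complex.one_re]
    linarith [hi₀ i (Finset.mem_univ _)]
  have hzi₀ : z i₀ = 1 := by simp [hzdef]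
  -- Step 7: limits of the factors
  have hfac : ∀ i, ∃ (e : ℕ) (c : ℂ), c ≠ 0 ∧ (i = i₀ → e = 1) ∧
      Tendsto (fun t : ℝ => (t : ℂ) ^ e * partialPairL S (α i) αd (z i + t)) (𝓝[>] (0 : ℝ))
        (𝓝 c) := by
    intro i
    by_cases hi : i = i₀
    · subst hi
      obtain ⟨c, hc, ht⟩ := hSB hSfin hSBS (hαS i) hσdS (huS i) hudS (fun w _ => rfl)
      refine ⟨1, c, hc, fun _ => rfl, ?_⟩
      simpa only [hzi₀, pow_one] using ht
    · obtain ⟨e, c, hc, -, ht⟩ := hSA i hSfin (hSAS i) (hαS i) hσdS (huS i) hudS (hzre i)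
      exact ⟨e, c, hc, fun h => (hi h).elim, ht⟩
  choose e c hc hei₀ hF using hfac
  -- the two left-hand factors have finite limits (`n ≠ m i₀`: no pole)
  obtain ⟨eL, cL, -, heL, hG⟩ := hSL hSfin hSLS hπuS hσdS hu₀S hudS hu₀re
  have heL0 : eL = 0 := heL hnm
  obtain ⟨eL', cL', -, heL', hG'⟩ := hSL' hSfin hSL'S hπcS hσdS hu₀cS hudS hu₀re
  have heL'0 : eL' = 0 := heL' hnm
  -- Step 8: the Euler-product identity for real `t > 0`
  have hident : ∀ t : ℝ, 0 < t →
      partialPairL S α₀ αd (u₀ + t) * partialPairL S α₀τ αd (u₀ + t) =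
        ∏ i, partialPairL S (α i) αd (z i + t) := by
    intro t ht
    have hre : 1 < (u₀ + (t : ℂ)).re := by
      simp only [Complex.add_re, Complex.ofReal_re]; linarith
    have hmu := hS2u hSfin hS2uS hπuS hσdS hu₀S hudS hre
    have hmc := hS2c hSfin hS2cS hπcS hσdS hu₀cS hudS hre
    have hmul : ∀ i, Multipliable fun v : {v : HeightOneSpectrum (𝓞 E) // v ∉ S} =>
        ((satakePairPolynomial (α i v.1) (αd v.1)).eval
          ((v.1.residueCard : ℂ) ^ (-(z i + t))))⁻¹ := fun i =>
      hS2 i hSfin (hS2S i) (hαS i) hσdS (huS i) hudS (z := z i + t)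
        (by simp only [Complex.add_re, Complex.ofReal_re]; linarith [hzre i])
    have hloc : ∀ v : {v : HeightOneSpectrum (𝓞 E) // v ∉ S},
        ((satakePairPolynomial (α₀ v.1) (αd v.1)).eval ((v.1.residueCard : ℂ) ^ (-(u₀ + t))))⁻¹ *
          ((satakePairPolynomial (α₀τ v.1) (αd v.1)).eval
            ((v.1.residueCard : ℂ) ^ (-(u₀ + t))))⁻¹ =
          ∏ i, ((satakePairPolynomial (α i v.1) (αd v.1)).eval
            ((v.1.residueCard : ℂ) ^ (-(z i + t))))⁻¹ := by
      intro v
      rw [← mul_inv, ← eval_mul, ← satakePairPolynomial_add_left]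
      change ((satakePairPolynomial (A v.1) (αd v.1)).eval _)⁻¹ = _
      rw [hrel' v.1 (hnot₁ v.1 v.2), satakePairPolynomial_sum_left, Polynomial.eval_prod,
        ← Finset.prod_inv_distrib]
      refine Finset.prod_congr rfl fun i _ => ?_
      rw [eval_satakePairPolynomial_map_mul_left, ← Complex.cpow_add _ _ (hq0 v.1)]
      congr 3
      simp only [hzdef, hu₀def]
      ring
    simp only [partialPairL]
    rw [← hmu.tprod_mul hmc, tprod_congr hloc]
    exact Multipliable.tprod_finsetProd fun i _ => hmul i
  -- Step 9: the contradiction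
  set N : ℕ := ∑ i, e i with hNdef
  have hN : 1 ≤ N := by
    rw [hNdef, ← hei₀ i₀ rfl]
    exact Finset.single_le_sum (fun i _ => Nat.zero_le (e i)) (Finset.mem_univ i₀)
  have hC : (∏ i, c i) ≠ 0 := Finset.prod_ne_zero_iff.mpr fun i _ => hc i
  have hR : Tendsto (fun t : ℝ => (t : ℂ) ^ N * ∏ i, partialPairL S (α i) αd (z i + t))
      (𝓝[>] (0 : ℝ)) (𝓝 (∏ i, c i)) := by
    have h := tendsto_finsetProd Finset.univ fun i (_ : i ∈ Finset.univ) => hF i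
    refine h.congr fun t => ?_
    rw [Finset.prod_mul_distrib, Finset.prod_pow_eq_pow_sum]
  have hL : Tendsto (fun t : ℝ => (t : ℂ) ^ N *
      (partialPairL S α₀ αd (u₀ + t) * partialPairL S α₀τ αd (u₀ + t)))
      (𝓝[>] (0 : ℝ)) (𝓝 0) := by
    have h0 : Tendsto (fun t : ℝ => (t : ℂ) ^ N) (𝓝[>] (0 : ℝ)) (𝓝 0) := by
      have : Tendsto (fun t : ℝ => (t : ℂ)) (𝓝[>] (0 : ℝ)) (𝓝 0) := by
        have h := (Complex.continuous_ofReal.tendsto (0 : ℝ)).mono_left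
          (nhdsWithin_le_nhds (s := Set.Ioi (0 : ℝ)))
        simpa using h
      simpa [zero_pow (by omega : N ≠ 0)] using this.pow N
    have hG₁ : Tendsto (fun t : ℝ => partialPairL S α₀ αd (u₀ + t)) (𝓝[>] (0 : ℝ)) (𝓝 cL) := by
      simpa only [heL0, pow_zero, one_mul] using hG
    have hG₂ : Tendsto (fun t : ℝ => partialPairL S α₀τ αd (u₀ + t)) (𝓝[>] (0 : ℝ)) (𝓝 cL') := by
      simpa only [heL'0, pow_zero, one_mul] using hG'
    simpa using h0.mul (hG₁.mul hG₂)
  have hL' : Tendsto (fun t : ℝ => (t : ℂ) ^ N * ∏ i, partialPairL S (α i) αd (z i + t))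
      (𝓝[>] (0 : ℝ)) (𝓝 0) := by
    refine hL.congr' ?_
    filter_upwards [self_mem_nhdsWithin] with t ht
    rw [hident t ht]
  exact hC (tendsto_nhds_unique hR hL')

end Rigidity

end Summit.Langlands.Langlands.Cruxes.SelfTwistedIrreducible.DetPinning

end
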